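import Summits.ResolutionOfSingularities.ResolutionOfSingularities.Theorems.PurelyInseparableDim4ChartDictionary
import Literature.AlgebraicGeometry.Resolution.AffineCoordinateBlowupCharts
import Literature.AlgebraicGeometry.Resolution.AffinePointBlowupChartTransfer
import Literature.AlgebraicGeometry.Resolution.MarkedIdealsEtale
import Literature.AlgebraicGeometry.Resolution.IdealSheafLemmas
import Literature.AlgebraicGeometry.Resolution.CobordantBlowup
import Mathlib.Algebra.MvPolynomial.Division
import HarnessLib

/-!
# Purely inseparable four-folds `z^p + F(x₁, …, x₄)`: the chart dictionary for coordinate centres,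
# SCHEME LEVEL I (brick TY-2 (b) of cell `res-dim4-pi`: chart transfer)

[OURS · counted 0] (D-0157 DOOR 2; director-resolution DR-157-C; desk `boards/WAVE2.md` row TY-2
«chart dictionary for coordinate centres = S3 (a)»). Sequel of the ring-level file
`PurelyInseparableDim4ChartDictionary.lean`. Setting: `K` a field, `P = 𝔸⁵_K = Spec K[z, x₁, …, x₄]`
(the tree's `AffinePointBlowup.P 4 K`, `z = X 0`, `xᵢ = X i.succ`), `S ⊆ {1, …, 4}`, the coordinate
subspace `V(z, x_S)` with reduced ideal sheaf `AffineCoordBlowup.𝓘Λ 4 K Λ_S`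
(`Λ_S = insert 0 (Fin.succ '' S)`), `F ∈ K[x₁, …, x₄]` with `p ≤ ord_{(x_S)} F` (the centre is
Hironaka-permissible for `z^p + F`, `PIDim4.IsPermissibleCentre`), and ANY blowing up
`π : W → P` of `𝓘Λ` (`IsBlowup`, universal property — not a chosen model). For `j ∈ S` the tree
provides the open immersion `AffineCoordBlowup.chartImm hπ hj : 𝔸⁵_K ⟶ W` onto the `x_j`-chart
`W[⊤, x_j]`, with `chartImm ≫ π = Spec ψ`, `ψ = coordBlowupSubst K Λ_S x_j`
(`AffineCoordinateBlowupCharts.lean`). PROVED here (no `sorry`, no new axiom):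

* `controlledTransform_specMap_subst`, **`controlledTransform_comap_chartImm`** — the controlled
  transform `σᶜ(𝓘, p) = (π^*𝓘 : 𝓘(D)^p)` (BGMW §3.2, the tree's `controlledTransform`) of the ideal
  sheaf `𝓘 = PIDim4.hypSheaf p F` of `z^p + F`, pulled back to the `x_j`-chart, IS the ideal sheaf of
  the new equation: `(σᶜ(𝓘, p)).comap chartImm = hypSheaf p (CentreBlowup.chartTransform p S j F)`;
  `comap_𝓘Λ_chartImm` — the exceptional divisor on the chart is the hyperplane `x_j = 0`.
* `strictTransformIdeal_comap_chartImm` — the STRICT transform (the saturation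
  `⋃ₙ (π^*𝓘 : 𝓘(D)ⁿ)`, the tree's `strictTransformIdeal`) gives the same ideal on the chart
  (`x_j ∤ z^p + F'` and `x_j` is prime): strict = controlled with `m = p` for this hypersurface.
* the composition with the re-centring/cleaning automorphism `Spec Θ` of `𝔸⁵` (giving
  `V(z^p + (CentreBlowup.step p S j b s).F)`, the desk's `strictTransform_chart_eq_step`) is the sequel
  `PurelyInseparableDim4ChartStep.lean`.

Mechanism: controlled transforms commute with flat base change (`comap_controlledTransform_of_flat`,
applied to the square `chartImm ≫ π = Spec ψ ≫ 𝟙`); on the affine space everything is an ideal of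
`K[z, x]` (`comap_ofIdealTop_of_isAffine`, `colon_ofIdealTop`, `ofIdealTop_pow/iSup`), where
`ψ(z^p + F) = x_j^p (z^p + F')` (ring-level file) and `((x_j^p g) : x_j^p) = (g)`,
`⋃ₙ ((x_j^p g) : x_jⁿ) = (g)` for `x_j ∤ g`. Nothing here is a statement about resolution of
singularities in dimension ≥ 4 / characteristic `p` (NOT proved anywhere in this programme); the
globalisation of the cell's local branches (frame `PIDim4.TerminationImpliesOrderReduction`) is NOT
addressed here. bears_on: LADDER-RESOLUTION:D157-DOOR2 (res-dim4-pi). Supports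
stmt-ResolutionOfSingularities-16155 (helper, TY-2 (b)).
-/

-- every declaration of this summit lives under `Summit.ResolutionOfSingularities.ResolutionOfSingularities`
-- (summit = problem), which the duplicate-namespace linter flags; house convention (cf. the Target file).
set_option linter.dupNamespace false

noncomputable section

open MvPolynomial Finset CategoryTheory AlgebraicGeometry Opposite
open AlgebraicGeometry.Scheme.IdealSheafData (ofIdealTop)

namespace Summit.ResolutionOfSingularities.ResolutionOfSingularities.Theorems.PIDim4

open Literature.AlgebraicGeometry.Resolution
open Literature.AlgebraicGeometry.Resolution.Hauser2010
open Literature.AlgebraicGeometry.Resolution.AffinePointBlowup (P A γ coord Wtop)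

namespace ChartDictionary

universe u

/-! ## §1 Two colon-ideal computations in a commutative ring -/

section Ring

variable {R : Type*} [CommRing R]

/-- `((a·g) : (a)) = (g)` for `a` a nonzerodivisor. -/
theorem colon_span_singleton_mul_eq {a : R} (ha : a ∈ nonZeroDivisors R) (g : R) :
    (Ideal.span {a * g}).colon ((Ideal.span {a} : Ideal R) : Set R) = Ideal.span {g} := by
  apply le_antisymm
  · intro r hr
    have h := Submodule.mem_colon.mp hr a (Ideal.mem_span_singleton_self a)
    rw [smul_eq_mul, Ideal.mem_span_singleton'] at h
    obtain ⟨c, hc⟩ := h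
    rw [Ideal.mem_span_singleton']
    refine ⟨c, (mul_cancel_right_mem_nonZeroDivisors ha).mp ?_⟩
    rw [← hc]
    ring
  · rw [Ideal.span_singleton_le_iff_mem]
    refine Submodule.mem_colon.mpr fun m hm => ?_
    obtain ⟨c, rfl⟩ := Ideal.mem_span_singleton'.mp hm
    rw [smul_eq_mul, Ideal.mem_span_singleton']
    exact ⟨c, by ring⟩

/-- Peeling off a prime `a ∤ g` in a domain: `r · a^m = c · g` forces `g ∣ r`. -/
theorem dvd_of_mul_pow_eq_mul [IsDomain R] {a g : R} (ha : Prime a) (hg : ¬ a ∣ g) :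
    ∀ (m : ℕ) (r c : R), r * a ^ m = c * g → g ∣ r := by
  intro m
  induction m with
  | zero =>
    intro r c h
    rw [pow_zero, mul_one] at h
    exact ⟨c, by rw [h, mul_comm]⟩
  | succ m ih =>
    intro r c h
    have hac : a ∣ c := by
      have h1 : a ∣ c * g := ⟨r * a ^ m, by rw [← h, pow_succ]; ring⟩
      exact (ha.dvd_or_dvd h1).resolve_right hg
    obtain ⟨c', rfl⟩ := hac
    refine ih r c' (mul_right_cancel₀ ha.ne_zero ?_)
    calc r * a ^ m * a = r * a ^ (m + 1) := by ring
      _ = a * c' * g := h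
      _ = c' * g * a := by ring

/-- `⋃ₙ ((a^p·g) : (a)ⁿ) = (g)` for `a` prime with `a ∤ g` in a domain (the saturation by the
exceptional divisor of the total transform `a^p·g` is already reached at the `p`-th step). -/
theorem iSup_colon_span_pow_mul_eq [IsDomain R] {a g : R} (ha : Prime a) (hg : ¬ a ∣ g) (p : ℕ) :
    ⨆ n : ℕ, (Ideal.span {a ^ p * g}).colon ((Ideal.span {a} ^ n : Ideal R) : Set R) =
      Ideal.span {g} := by
  apply le_antisymm
  · refine iSup_le fun n => ?_
    intro r hr
    rw [Ideal.span_singleton_pow] at hr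
    have h := Submodule.mem_colon.mp hr (a ^ n) (Ideal.mem_span_singleton_self _)
    rw [smul_eq_mul, Ideal.mem_span_singleton'] at h
    obtain ⟨c, hc⟩ := h
    rw [Ideal.mem_span_singleton]
    rcases le_or_gt p n with hpn | hnp
    · -- `a^p (r a^{n-p}) = a^p (c g)`
      refine dvd_of_mul_pow_eq_mul ha hg (n - p) r c (mul_left_cancel₀ (pow_ne_zero p ha.ne_zero) ?_)
      calc a ^ p * (r * a ^ (n - p)) = r * a ^ n := by
            rw [mul_left_comm, ← pow_add, Nat.add_sub_cancel' hpn]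
        _ = c * (a ^ p * g) := hc.symm
        _ = a ^ p * (c * g) := by ring
    · -- `r = c a^{p-n} g`
      refine ⟨c * a ^ (p - n), mul_right_cancel₀ (pow_ne_zero n ha.ne_zero) ?_⟩
      calc r * a ^ n = c * (a ^ p * g) := hc.symm
        _ = g * (c * a ^ (p - n)) * a ^ n := by
            rw [show a ^ p = a ^ (p - n) * a ^ n by rw [← pow_add, Nat.sub_add_cancel hnp.le]]
            ring
  · refine le_trans ?_ (le_iSup _ p)
    rw [Ideal.span_singleton_pow, colon_span_singleton_mul_eq
      (mem_nonZeroDivisors_of_ne_zero (pow_ne_zero p ha.ne_zero))]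

end Ring

/-! ## §2 Ideal sheaves on `𝔸ⁿ⁺¹_K` given by one polynomial, and their inverse images -/

section Affine

variable {n : ℕ} {K : Type} [Field K]

/-- `(Spec φ)^*` on global sections, in the coordinates `γ : Γ(𝔸ⁿ⁺¹, ⊤) ≅ K[x]`: `γ⁻¹ a ↦ γ⁻¹ (φ a)`. -/
theorem appTop_specMap_γ_symm (φ : A n K →+* A n K) (a : A n K) :
    (Spec.map (CommRingCat.ofHom φ)).appTop.hom ((γ n K).symm a) = (γ n K).symm (φ a) := by
  have h := congrArg (fun F => CommRingCat.Hom.hom F a)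
    (Scheme.ΓSpecIso_inv_naturality (CommRingCat.ofHom φ))
  simp only [CommRingCat.hom_comp, RingHom.comp_apply, CommRingCat.hom_ofHom] at h
  rw [AffinePointBlowup.γ_symm_apply, AffinePointBlowup.γ_symm_apply]
  exact h.symm

/-- **Inverse image of the ideal sheaf of one polynomial** along `Spec φ : 𝔸ⁿ⁺¹ → 𝔸ⁿ⁺¹`:
`(γ⁻¹ a) · 𝒪 ↦ (γ⁻¹ (φ a)) · 𝒪`. -/
theorem comap_ofIdealTop_span_γ_symm (φ : A n K →+* A n K) (a : A n K) :
    (ofIdealTop (Ideal.span {(γ n K).symm a})).comap (Spec.map (CommRingCat.ofHom φ)) =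
      ofIdealTop (Ideal.span {(γ n K).symm (φ a)}) := by
  rw [comap_ofIdealTop_of_isAffine, Ideal.map_span, Set.image_singleton, appTop_specMap_γ_symm]

/-- The ideal sheaf of the coordinate subspace `C_Λ` is the ideal sheaf of the ideal `(xᵢ : i ∈ Λ)` of
global sections (affine bookkeeping over the tree's `AffineCoordBlowup.ideal_𝓘Λ_top`). -/
theorem 𝓘Λ_eq_ofIdealTop (Λ : Set (Fin (n + 1))) :
    AffineCoordBlowup.𝓘Λ n K Λ = ofIdealTop (Ideal.span (coord n K '' Λ)) :=
  Scheme.IdealSheafData.ext_of_isAffine (by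
    rw [ideal_ofIdealTop_top]
    exact AffineCoordBlowup.ideal_𝓘Λ_top n K Λ)

/-- **The exceptional divisor of the `xᵢ`-chart is the hyperplane `xᵢ = 0`**: along
`Spec ψ : 𝔸ⁿ⁺¹ → 𝔸ⁿ⁺¹`, `ψ = coordBlowupSubst K Λ i` (`i ∈ Λ`), the ideal sheaf of `C_Λ` pulls back to
`xᵢ · 𝒪` (the tree's `map_coordBlowupSubst_span_eq`: `ψ(I_Λ)·K[x] = (xᵢ)`). -/
theorem comap_𝓘Λ_specMap_subst {Λ : Set (Fin (n + 1))} {i : Fin (n + 1)} (hi : i ∈ Λ) :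
    (AffineCoordBlowup.𝓘Λ n K Λ).comap
        (Spec.map (CommRingCat.ofHom (coordBlowupSubst K Λ i).toRingHom)) =
      ofIdealTop (Ideal.span {coord n K i}) := by
  rw [𝓘Λ_eq_ofIdealTop, comap_ofIdealTop_of_isAffine, ← AffineCoordBlowup.map_symm_IΛ, Ideal.map_map]
  have hc : ((Spec.map (CommRingCat.ofHom (coordBlowupSubst K Λ i).toRingHom)).appTop.hom).comp
      ((γ n K).symm : A n K →+* Γ(P n K, Wtop n K)) =
      ((γ n K).symm : A n K →+* Γ(P n K, Wtop n K)).comp (coordBlowupSubst K Λ i).toRingHom :=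
    RingHom.ext fun a => appTop_specMap_γ_symm _ a
  have hmap : (AffineCoordBlowup.IΛ n K Λ).map (coordBlowupSubst K Λ i).toRingHom =
      Ideal.span {(X i : A n K)} :=
    map_coordBlowupSubst_span_eq K Λ i hi
  rw [hc, ← Ideal.map_map, hmap, Ideal.map_span, Set.image_singleton]
  rfl

end Affine

/-! ## §3 The controlled and strict transforms of `V(z^p + F)` on the `x_j`-chart -/

section Chart

variable {K : Type} [Field K]

/-- `x_j^q ∈ Γ(𝔸⁵, ⊤)` is a nonzerodivisor. -/
theorem coord_pow_mem_nonZeroDivisors (i : Fin (4 + 1)) (q : ℕ) :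
    coord 4 K i ^ q ∈ nonZeroDivisors Γ(P 4 K, Wtop 4 K) :=
  mem_nonZeroDivisors_of_ne_zero (pow_ne_zero q (AffinePointBlowup.coord_ne_zero 4 K i))

/-- `x_j ∈ Γ(𝔸⁵, ⊤)` is prime (a variable of a polynomial ring over a field, transported along `γ`). -/
theorem prime_coord (i : Fin (4 + 1)) : Prime (coord 4 K i) := by
  have h : Prime (X i : A 4 K) := MvPolynomial.X_prime
  rw [← MulEquiv.prime_iff (γ 4 K).symm.toMulEquiv] at h
  exact h

/-- `x_j ∤ z^p + G(x)` in `K[z, x]` (`p ≠ 0`): the monomial `z^p` survives. -/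
theorem not_X_succ_dvd_hyp {p : ℕ} (hp : p ≠ 0) (j : Fin 4) (G : MvPolynomial (Fin 4) K) :
    ¬ (X j.succ : MvPolynomial (Fin (4 + 1)) K) ∣ hyp p G := by
  rintro ⟨c, hc⟩
  have h1 : coeff (Finsupp.single 0 p) (hyp p G) = 1 := by
    rw [hyp, coeff_add, coeff_X_pow, if_pos rfl, coeff_rename_eq_zero, add_zero]
    intro u hu
    exfalso
    have h0 := DFunLike.congr_fun hu 0
    rw [Finsupp.mapDomain_notin_range, Finsupp.single_eq_same] at h0
    · exact hp h0.symm
    · rintro ⟨i, hi⟩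
      exact Fin.succ_ne_zero i hi
  have h2 : coeff (Finsupp.single 0 p) (X j.succ * c) = 0 := by
    rw [coeff_X_mul', if_neg]
    rw [Finsupp.mem_support_iff, Finsupp.single_apply, if_neg (Fin.succ_ne_zero j).symm]
    exact fun h => h rfl
  rw [hc, h2] at h1
  exact zero_ne_one h1

/-- `x_j ∤ γ⁻¹(z^p + G)` in `Γ(𝔸⁵, ⊤)`. -/
theorem not_coord_dvd_γ_symm_hyp {p : ℕ} (hp : p ≠ 0) (j : Fin 4) (G : MvPolynomial (Fin 4) K) :
    ¬ coord 4 K j.succ ∣ (γ 4 K).symm (hyp p G) := by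
  rintro ⟨c, hc⟩
  apply not_X_succ_dvd_hyp hp j G
  refine ⟨γ 4 K c, ?_⟩
  have h := congrArg (γ 4 K) hc
  rwa [RingEquiv.apply_symm_apply, map_mul, AffinePointBlowup.γ_coord] at h

/-- **The controlled transform along the chart substitution** `Spec ψ : 𝔸⁵ → 𝔸⁵`
(`ψ = coordBlowupSubst K Λ_S x_j`, `j ∈ S`, `q ≤ ord_{(x_S)} F`): `(ψ^*(z^q + F)·𝒪 : (x_j)^q) =
(z^q + F')·𝒪`, `F' = CentreBlowup.chartTransform q S j F` — since `ψ(z^q + F) = x_j^q (z^q + F')`. -/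
theorem controlledTransform_specMap_subst (q : ℕ) {S : Finset (Fin 4)} {j : Fin 4} (hj : j ∈ S)
    (F : MvPolynomial (Fin 4) K) (hperm : (q : ℕ∞) ≤ CentreBlowup.ordAlong S F) :
    controlledTransform
        (Spec.map (CommRingCat.ofHom
          (coordBlowupSubst K (insert 0 (Fin.succ '' (S : Set (Fin 4)))) j.succ).toRingHom))
        (AffineCoordBlowup.𝓘Λ 4 K (insert 0 (Fin.succ '' (S : Set (Fin 4))))) (hypSheaf q F) q =
      hypSheaf q (CentreBlowup.chartTransform q S j F) := by
  rw [controlledTransform, comap_𝓘Λ_specMap_subst (succ_mem_centreVars hj), hypSheaf, hypSheaf,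
    ← ofIdealTop_pow, Ideal.span_singleton_pow]
  rw [show (ofIdealTop (Ideal.span {(γ 4 K).symm (hyp q F)})).comap
      (Spec.map (CommRingCat.ofHom
        (coordBlowupSubst K (insert 0 (Fin.succ '' (S : Set (Fin 4)))) j.succ).toRingHom)) =
      ofIdealTop (Ideal.span {coord 4 K j.succ ^ q * (γ 4 K).symm (hyp q (CentreBlowup.chartTransform q S j F))})
    from by
      rw [comap_ofIdealTop_span_γ_symm]
      change ofIdealTop (Ideal.span {(γ 4 K).symm (coordBlowupSubst K _ j.succ (hyp q F))}) = _
      rw [coordBlowupSubst_hyp q hj F hperm, map_mul, map_pow]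
      rfl]
  rw [colon_ofIdealTop, colon_span_singleton_mul_eq (coord_pow_mem_nonZeroDivisors j.succ q)]

/-- **The strict transform along the chart substitution**: the saturation
`⋃ₙ (ψ^*(z^p + F)·𝒪 : (x_j)ⁿ)` is the same ideal sheaf `(z^p + F')·𝒪` (`p ≠ 0`; `x_j` is prime and
does not divide `z^p + F'`). -/
theorem strictTransformIdeal_specMap_subst {p : ℕ} (hp : p ≠ 0) {S : Finset (Fin 4)} {j : Fin 4}
    (hj : j ∈ S) (F : MvPolynomial (Fin 4) K) (hperm : (p : ℕ∞) ≤ CentreBlowup.ordAlong S F) :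
    strictTransformIdeal
        (Spec.map (CommRingCat.ofHom
          (coordBlowupSubst K (insert 0 (Fin.succ '' (S : Set (Fin 4)))) j.succ).toRingHom))
        (AffineCoordBlowup.𝓘Λ 4 K (insert 0 (Fin.succ '' (S : Set (Fin 4))))) (hypSheaf p F) =
      hypSheaf p (CentreBlowup.chartTransform p S j F) := by
  rw [strictTransformIdeal, comap_𝓘Λ_specMap_subst (succ_mem_centreVars hj), hypSheaf, hypSheaf,
    comap_ofIdealTop_span_γ_symm]
  change ⨆ m : ℕ, colon (ofIdealTop (Ideal.span {(γ 4 K).symm (coordBlowupSubst K _ j.succ (hyp p F))}))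
      (ofIdealTop (Ideal.span {coord 4 K j.succ}) ^ m) = _
  rw [coordBlowupSubst_hyp p hj F hperm, map_mul, map_pow]
  have hcoord : (γ 4 K).symm (X j.succ) = coord 4 K j.succ := rfl
  rw [hcoord]
  simp_rw [← ofIdealTop_pow, colon_ofIdealTop]
  rw [← ofIdealTop_iSup, iSup_colon_span_pow_mul_eq (prime_coord j.succ)
    (not_coord_dvd_γ_symm_hyp hp j _)]

variable {S : Finset (Fin 4)} {j : Fin 4} {W : Scheme.{0}} {π : W ⟶ P 4 K}

/-- **The exceptional divisor on the `x_j`-chart of ANY blowing up of `𝔸⁵` along `V(z, x_S)` is the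
hyperplane `x_j = 0`**: `(π⁻¹𝓘Λ · 𝒪_W)|_{chart} = x_j · 𝒪`. -/
theorem comap_𝓘Λ_chartImm (hj : j ∈ S)
    (hπ : IsBlowup π (AffineCoordBlowup.𝓘Λ 4 K (insert 0 (Fin.succ '' (S : Set (Fin 4)))))) :
    ((AffineCoordBlowup.𝓘Λ 4 K (insert 0 (Fin.succ '' (S : Set (Fin 4))))).comap π).comap
        (AffineCoordBlowup.chartImm hπ (succ_mem_centreVars hj)) =
      ofIdealTop (Ideal.span {coord 4 K j.succ}) := by
  rw [← Scheme.IdealSheafData.comap_comp, AffineCoordBlowup.chartImm_comp hπ (succ_mem_centreVars hj),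
    comap_𝓘Λ_specMap_subst (succ_mem_centreVars hj)]

/-- **CHART TRANSFER (controlled transform).** For ANY blowing up `π : W → 𝔸⁵_K` along `V(z, x_S)`,
`j ∈ S` and `q ≤ ord_{(x_S)} F`, the controlled transform `σᶜ((z^q + F)·𝒪, q) = (π^*𝓘 : 𝓘(D)^q)`
(BGMW §3.2) restricted to the `x_j`-chart `𝔸⁵_K ↪ W` is the ideal sheaf of the new equation
`z^q + CentreBlowup.chartTransform q S j F`. -/
theorem controlledTransform_comap_chartImm (q : ℕ) (hj : j ∈ S) (F : MvPolynomial (Fin 4) K)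
    (hperm : (q : ℕ∞) ≤ CentreBlowup.ordAlong S F)
    (hπ : IsBlowup π (AffineCoordBlowup.𝓘Λ 4 K (insert 0 (Fin.succ '' (S : Set (Fin 4)))))) :
    (controlledTransform π (AffineCoordBlowup.𝓘Λ 4 K (insert 0 (Fin.succ '' (S : Set (Fin 4)))))
        (hypSheaf q F) q).comap (AffineCoordBlowup.chartImm hπ (succ_mem_centreVars hj)) =
      hypSheaf q (CentreBlowup.chartTransform q S j F) := by
  haveI : IsProper π := hπ.isProper
  haveI : IsLocallyNoetherian W := LocallyOfFiniteType.isLocallyNoetherian π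
  have hsq : AffineCoordBlowup.chartImm hπ (succ_mem_centreVars hj) ≫ π =
      Spec.map (CommRingCat.ofHom
        (coordBlowupSubst K (insert 0 (Fin.succ '' (S : Set (Fin 4)))) j.succ).toRingHom) ≫ 𝟙 (P 4 K) := by
    rw [Category.comp_id]
    exact AffineCoordBlowup.chartImm_comp hπ (succ_mem_centreVars hj)
  rw [comap_controlledTransform_of_flat (t := 𝟙 (P 4 K)) hsq, Scheme.IdealSheafData.comap_id,
    Scheme.IdealSheafData.comap_id, controlledTransform_specMap_subst q hj F hperm]

/-- **CHART TRANSFER (strict transform).** Same, for the strict transform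
`⋃ₙ (π^*(z^p + F)·𝒪 : 𝓘(D)ⁿ)` (`p ≠ 0`): on the `x_j`-chart it is `(z^p + F')·𝒪` as well. -/
theorem strictTransformIdeal_comap_chartImm {p : ℕ} (hp : p ≠ 0) (hj : j ∈ S) (F : MvPolynomial (Fin 4) K)
    (hperm : (p : ℕ∞) ≤ CentreBlowup.ordAlong S F)
    (hπ : IsBlowup π (AffineCoordBlowup.𝓘Λ 4 K (insert 0 (Fin.succ '' (S : Set (Fin 4)))))) :
    (strictTransformIdeal π (AffineCoordBlowup.𝓘Λ 4 K (insert 0 (Fin.succ '' (S : Set (Fin 4)))))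
        (hypSheaf p F)).comap (AffineCoordBlowup.chartImm hπ (succ_mem_centreVars hj)) =
      hypSheaf p (CentreBlowup.chartTransform p S j F) := by
  haveI : IsProper π := hπ.isProper
  haveI : IsLocallyNoetherian W := LocallyOfFiniteType.isLocallyNoetherian π
  have hsq : AffineCoordBlowup.chartImm hπ (succ_mem_centreVars hj) ≫ π =
      Spec.map (CommRingCat.ofHom
        (coordBlowupSubst K (insert 0 (Fin.succ '' (S : Set (Fin 4)))) j.succ).toRingHom) ≫ 𝟙 (P 4 K) := by
    rw [Category.comp_id]
    exact AffineCoordBlowup.chartImm_comp hπ (succ_mem_centreVars hj)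
  rw [comap_strictTransformIdeal_of_flat (t := 𝟙 (P 4 K)) hsq, Scheme.IdealSheafData.comap_id,
    Scheme.IdealSheafData.comap_id, strictTransformIdeal_specMap_subst hp hj F hperm]

end Chart

end ChartDictionary

end Summit.ResolutionOfSingularities.ResolutionOfSingularities.Theorems.PIDim4

end
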